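import Literature.Computability.FineGrained.MinPlusToNegativeTriangleSweepProgram
import HarnessLib

/-!
# Distance product `≤₃` Negative Triangle: the verified blocks `blockCopy` and `buildT`

Symbolic execution of the two inner loops of the product step `psNT`
(`Literature.Computability.FineGrained.MinPlusToNegativeTriangleSweepProgram`; Vassilevska
Williams–Williams, J. ACM 65 (2018), Thm. 4.2): `blockCopy` (an `L × L` block of operand codes
into the query matrix, `⊤` and out-of-range entries as non-edges: `blockCopy_spec`, value `bcVal`)
and `buildT` (the back arcs of the query graph for a window: `buildT_spec`, value `tbVal`), in the
idiom of `Literature.Computability.FineGrained.APSPPowerDriver` (one `execOps_cons_fwd` step and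
one read-normalising `simp only` per instruction, closed-form `∃`-interfaces between blocks, the
counted loop rule `ExecLE.whilenz_invariant`).

## References

* V. Vassilevska Williams, R. R. Williams, *Subcubic equivalences between path, matrix, and
  triangle problems*, J. ACM 65 (2018), Art. 27, Thm. 4.2 (p. 27:14; proof pp. 27:17–18).
* T. Nipkow, G. Klein, *Concrete Semantics with Isabelle/HOL*, Springer 2014, §7, §12.
-/

namespace Literature.Computability.FineGrained.NegTriSweep

open Cryptography Cryptography.WordRAM Cryptography.WordRAM.SProg APSPPower NegTriStep

set_option linter.unusedSimpArgs false

/-! ## Small arithmetic -/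

/-- `a &&& b = a b` on bits. [folklore] -/
theorem band_bit {a b : ℕ} (ha : a ≤ 1) (hb : b ≤ 1) : a &&& b = a * b := by
  interval_cases a <;> interval_cases b <;> decide

/-- Wrapping subtraction of words vanishes iff the words are equal. [folklore] -/
theorem BinOp_sub_eq_zero_iff {w x y : ℕ} (hx : x < 2 ^ w) (hy : y < 2 ^ w) :
    BinOp.sub.eval w x y = 0 ↔ x = y := by
  show (x + 2 ^ w - y % 2 ^ w) % 2 ^ w = 0 ↔ x = y
  rw [Nat.mod_eq_of_lt hy]
  constructor
  · intro h
    by_cases hxy : y ≤ x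
    · rw [Nat.sub_add_comm hxy, Nat.add_mod_right, Nat.mod_eq_of_lt (by omega)] at h; omega
    · rw [Nat.mod_eq_of_lt (by omega)] at h; omega
  · rintro rfl; rw [Nat.add_sub_cancel_left, Nat.mod_self]

/-- The positivity flag of a wrapping difference is the disequality flag. [folklore] -/
theorem flag_sub_ne {w x y : ℕ} (hx : x < 2 ^ w) (hy : y < 2 ^ w) :
    (if 0 < BinOp.sub.eval w x y then 1 else 0) = if x = y then 0 else 1 := by
  by_cases h : x = y
  · rw [if_pos h, if_neg]; rw [(BinOp_sub_eq_zero_iff hx hy).2 h]; omega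
  · rw [if_neg h, if_pos]; exact Nat.pos_of_ne_zero fun h0 => h ((BinOp_sub_eq_zero_iff hx hy).1 h0)

/-- Row-major offsets inside an `L × L3`-strided block. [folklore] -/
theorem div_mul_add_mod_lt {r L L3 : ℕ} (hL : 1 ≤ L) (hr : r < L * L) (hL3 : L ≤ L3) :
    r / L * L3 + r % L < L * L3 := by
  have h1 : r / L < L := Nat.div_lt_of_lt_mul hr
  have h2 : r % L < L := Nat.mod_lt _ (by omega)
  calc r / L * L3 + r % L < r / L * L3 + L3 := by omega
    _ = (r / L + 1) * L3 := by ring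
    _ ≤ L * L3 := Nat.mul_le_mul_right _ h1

/-! ## `blockCopy`: one iteration -/

/-- The value written by one iteration of `blockCopy` for the block entry `(il, kl)`: the source
code if the global pair is in range and the code is not that of `⊤`, the non-edge code otherwise.
(Stated as a bare `if`; cf. `QData.entryOr`.) [folklore] -/
theorem blockCopy_iter {w : ℕ} {O : List ℕ → List ℕ} {n L L3 BIGC src ro co dst r : ℕ}
    {S H : ℕ → ℕ} {qs : List (List ℕ)}
    (h2 : S 2 = n) (h24 : S 24 = BIGC) (h25 : S 25 = L) (h27 : S 27 = L3) (h60 : S 60 = r + 1)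
    (h61 : S 61 = src) (h62 : S 62 = ro) (h63 : S 63 = co) (h64 : S 64 = dst)
    (hn : 1 ≤ n) (hL : 1 ≤ L) (hL3 : L3 = 3 * L) (hr : r < L * L) (hro : ro < n) (hco : co < n)
    (hsrc : 100 ≤ src) (hdst : 100 ≤ dst)
    (hsrcv : ∀ t, t < n * n → H (src + t) ≤ BIGC)
    (hcapB : 2 * BIGC < 2 ^ w) (hcapN : (n + L) * n + (n + L) < 2 ^ w) (hcapS : src + n * n < 2 ^ w)
    (hcapD : dst + L * L3 < 2 ^ w) :
    ∃ S' H', Exec w O (seqs [block blockCopyOps1, block blockCopyOps2]) ⟨merge S H, qs⟩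
        ⟨merge S' H', qs⟩ 23 ∧
      (∀ i, i ≠ 60 → i ≠ 65 → i ≠ 66 → i ≠ 67 → i ≠ 68 → i ≠ 69 → i ≠ 70 → S' i = S i) ∧
      S' 60 = r ∧
      H' = Function.update H (dst + r / L * L3 + r % L) (bcVal H n BIGC src ro co (r / L) (r % L)) := by
  have hil : r / L < L := Nat.div_lt_of_lt_mul hr
  have hkl : r % L < L := Nat.mod_lt _ (by omega)
  have hLn : L ≤ n + L := by omega
  have han : (ro + r / L) * n ≤ (n + L) * n := Nat.mul_le_mul_right _ (by omega)
  have hoff : r / L * L3 + r % L < L * L3 := div_mul_add_mod_lt hL hr (by omega)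
  -- block 1
  have hLL3 : L * L ≤ L * L3 := Nat.mul_le_mul_left _ (by omega)
  obtain ⟨st₁, hex₁, S₁, rfl, hS₁, h60₁, h65₁, h66₁, h69₁, h68₁, hcxB⟩ : ∃ st₁, Exec w O (block blockCopyOps1)
      ⟨merge S H, qs⟩ st₁ 13 ∧ ∃ S₁, st₁ = ⟨merge S₁ H, qs⟩ ∧
      (∀ i, i ≠ 60 → i ≠ 65 → i ≠ 66 → i ≠ 67 → i ≠ 68 → i ≠ 69 → i ≠ 70 → S₁ i = S i) ∧
      S₁ 60 = r ∧ S₁ 65 = r / L ∧ S₁ 66 = r % L ∧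
      S₁ 69 = (if ro + r / L < n ∧ co + r % L < n then 1 else 0) ∧
      S₁ 68 = (if ro + r / L < n ∧ co + r % L < n then H (src + ((ro + r / L) * n + (co + r % L)))
        else H src) ∧ S₁ 68 ≤ BIGC := by
    refine Exec.block_of_fwd _ _ fun R hR => ?_
    unfold blockCopyOps1 at hR
    have htmp := execOps_cons_fwd hR; clear hR; obtain ⟨v1, hv1, hR⟩ := htmp
    simp -failIfUnchanged (disch := omega) only [Operand.write, Operand.read, merge_apply_of_lt,
      merge_apply_of_le, Function.update_self, Function.update_of_ne, update_merge_of_lt,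
      update_merge_of_le, Nat.add_zero, Nat.zero_add, BinOp.eval_mod, BinOp.eval_eq, BinOp.eval_band,
      BinOp.eval_shr, BinOp.eval_div, BinOp.eval_lt, BinOp.eval_add_of_lt, BinOp.eval_sub_of_le,
      BinOp.eval_mul_of_lt, h2, h24, h25, h27, h60, h61, h62, h63, h64] at hv1 hR
    simp only [Nat.add_sub_cancel] at hv1; subst hv1
    have htmp := execOps_cons_fwd hR; clear hR; obtain ⟨v2, hv2, hR⟩ := htmp
    simp -failIfUnchanged (disch := omega) only [Operand.write, Operand.read, merge_apply_of_lt,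
      merge_apply_of_le, Function.update_self, Function.update_of_ne, update_merge_of_lt,
      update_merge_of_le, Nat.add_zero, Nat.zero_add, BinOp.eval_mod, BinOp.eval_eq, BinOp.eval_band,
      BinOp.eval_shr, BinOp.eval_div, BinOp.eval_lt, BinOp.eval_add_of_lt, BinOp.eval_sub_of_le,
      BinOp.eval_mul_of_lt, h2, h24, h25, h27, h60, h61, h62, h63, h64] at hv2 hR
    have hv2L : v2 < L := hv2 ▸ hil
    have htmp := execOps_cons_fwd hR; clear hR; obtain ⟨v3, hv3, hR⟩ := htmp
    simp -failIfUnchanged (disch := omega) only [Operand.write, Operand.read, merge_apply_of_lt,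
      merge_apply_of_le, Function.update_self, Function.update_of_ne, update_merge_of_lt,
      update_merge_of_le, Nat.add_zero, Nat.zero_add, BinOp.eval_mod, BinOp.eval_eq, BinOp.eval_band,
      BinOp.eval_shr, BinOp.eval_div, BinOp.eval_lt, BinOp.eval_add_of_lt, BinOp.eval_sub_of_le,
      BinOp.eval_mul_of_lt, h2, h24, h25, h27, h60, h61, h62, h63, h64] at hv3 hR
    have hv3L : v3 < L := hv3 ▸ hkl
    have htmp := execOps_cons_fwd hR; clear hR; obtain ⟨v4, hv4, hR⟩ := htmp
    simp -failIfUnchanged (disch := omega) only [Operand.write, Operand.read, merge_apply_of_lt,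
      merge_apply_of_le, Function.update_self, Function.update_of_ne, update_merge_of_lt,
      update_merge_of_le, Nat.add_zero, Nat.zero_add, BinOp.eval_mod, BinOp.eval_eq, BinOp.eval_band,
      BinOp.eval_shr, BinOp.eval_div, BinOp.eval_lt, BinOp.eval_add_of_lt, BinOp.eval_sub_of_le,
      BinOp.eval_mul_of_lt, h2, h24, h25, h27, h60, h61, h62, h63, h64] at hv4 hR
    have htmp := execOps_cons_fwd hR; clear hR; obtain ⟨v5, hv5, hR⟩ := htmp
    simp -failIfUnchanged (disch := omega) only [Operand.write, Operand.read, merge_apply_of_lt,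
      merge_apply_of_le, Function.update_self, Function.update_of_ne, update_merge_of_lt,
      update_merge_of_le, Nat.add_zero, Nat.zero_add, BinOp.eval_mod, BinOp.eval_eq, BinOp.eval_band,
      BinOp.eval_shr, BinOp.eval_div, BinOp.eval_lt, BinOp.eval_add_of_lt, BinOp.eval_sub_of_le,
      BinOp.eval_mul_of_lt, h2, h24, h25, h27, h60, h61, h62, h63, h64] at hv5 hR
    have htmp := execOps_cons_fwd hR; clear hR; obtain ⟨v6, hv6, hR⟩ := htmp
    simp -failIfUnchanged (disch := omega) only [Operand.write, Operand.read, merge_apply_of_lt,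
      merge_apply_of_le, Function.update_self, Function.update_of_ne, update_merge_of_lt,
      update_merge_of_le, Nat.add_zero, Nat.zero_add, BinOp.eval_mod, BinOp.eval_eq, BinOp.eval_band,
      BinOp.eval_shr, BinOp.eval_div, BinOp.eval_lt, BinOp.eval_add_of_lt, BinOp.eval_sub_of_le,
      BinOp.eval_mul_of_lt, h2, h24, h25, h27, h60, h61, h62, h63, h64] at hv6 hR
    have hv6' : v6 ≤ 1 := hv6 ▸ NegTriToAPSP.ite_le_one _
    have htmp := execOps_cons_fwd hR; clear hR; obtain ⟨v7, hv7, hR⟩ := htmp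
    simp -failIfUnchanged (disch := omega) only [Operand.write, Operand.read, merge_apply_of_lt,
      merge_apply_of_le, Function.update_self, Function.update_of_ne, update_merge_of_lt,
      update_merge_of_le, Nat.add_zero, Nat.zero_add, BinOp.eval_mod, BinOp.eval_eq, BinOp.eval_band,
      BinOp.eval_shr, BinOp.eval_div, BinOp.eval_lt, BinOp.eval_add_of_lt, BinOp.eval_sub_of_le,
      BinOp.eval_mul_of_lt, h2, h24, h25, h27, h60, h61, h62, h63, h64] at hv7 hR
    have hv7' : v7 ≤ 1 := hv7 ▸ NegTriToAPSP.ite_le_one _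
    have htmp := execOps_cons_fwd hR; clear hR; obtain ⟨v8, hv8, hR⟩ := htmp
    simp -failIfUnchanged (disch := omega) only [Operand.write, Operand.read, merge_apply_of_lt,
      merge_apply_of_le, Function.update_self, Function.update_of_ne, update_merge_of_lt,
      update_merge_of_le, Nat.add_zero, Nat.zero_add, BinOp.eval_mod, BinOp.eval_eq, BinOp.eval_band,
      BinOp.eval_shr, BinOp.eval_div, BinOp.eval_lt, BinOp.eval_add_of_lt, BinOp.eval_sub_of_le,
      BinOp.eval_mul_of_lt, h2, h24, h25, h27, h60, h61, h62, h63, h64] at hv8 hR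
    rw [band_bit hv6' hv7'] at hv8
    have hv8' : v8 ≤ 1 := hv8 ▸ mul_le_one' hv6' hv7'
    have h9 : v4 * n ≤ (n + L) * n := Nat.mul_le_mul_right _ (by omega)
    have htmp := execOps_cons_fwd hR; clear hR; obtain ⟨v9, hv9, hR⟩ := htmp
    simp -failIfUnchanged (disch := omega) only [Operand.write, Operand.read, merge_apply_of_lt,
      merge_apply_of_le, Function.update_self, Function.update_of_ne, update_merge_of_lt,
      update_merge_of_le, Nat.add_zero, Nat.zero_add, BinOp.eval_mod, BinOp.eval_eq, BinOp.eval_band,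
      BinOp.eval_shr, BinOp.eval_div, BinOp.eval_lt, BinOp.eval_add_of_lt, BinOp.eval_sub_of_le,
      BinOp.eval_mul_of_lt, h2, h24, h25, h27, h60, h61, h62, h63, h64] at hv9 hR
    have htmp := execOps_cons_fwd hR; clear hR; obtain ⟨v10, hv10, hR⟩ := htmp
    simp -failIfUnchanged (disch := omega) only [Operand.write, Operand.read, merge_apply_of_lt,
      merge_apply_of_le, Function.update_self, Function.update_of_ne, update_merge_of_lt,
      update_merge_of_le, Nat.add_zero, Nat.zero_add, BinOp.eval_mod, BinOp.eval_eq, BinOp.eval_band,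
      BinOp.eval_shr, BinOp.eval_div, BinOp.eval_lt, BinOp.eval_add_of_lt, BinOp.eval_sub_of_le,
      BinOp.eval_mul_of_lt, h2, h24, h25, h27, h60, h61, h62, h63, h64] at hv10 hR
    have h11 : v10 * v8 ≤ v10 := by simpa using Nat.mul_le_mul_left v10 hv8'
    have htmp := execOps_cons_fwd hR; clear hR; obtain ⟨v11, hv11, hR⟩ := htmp
    simp -failIfUnchanged (disch := omega) only [Operand.write, Operand.read, merge_apply_of_lt,
      merge_apply_of_le, Function.update_self, Function.update_of_ne, update_merge_of_lt,
      update_merge_of_le, Nat.add_zero, Nat.zero_add, BinOp.eval_mod, BinOp.eval_eq, BinOp.eval_band,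
      BinOp.eval_shr, BinOp.eval_div, BinOp.eval_lt, BinOp.eval_add_of_lt, BinOp.eval_sub_of_le,
      BinOp.eval_mul_of_lt, h2, h24, h25, h27, h60, h61, h62, h63, h64] at hv11 hR
    have h11' : v11 < n * n := by
      rw [← hv11, ← hv8, ← hv6, ← hv7]
      by_cases ha : v4 < n
      · by_cases hb : v5 < n
        · rw [if_pos ha, if_pos hb, Nat.mul_one, ← hv10, ← hv9]; exact NegTriToAPSP.mul_add_lt_mul ha hb
        · rw [if_neg hb, Nat.mul_zero, Nat.mul_zero]; exact Nat.mul_pos hn hn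
      · rw [if_neg ha, Nat.zero_mul, Nat.mul_zero]; exact Nat.mul_pos hn hn
    have htmp := execOps_cons_fwd hR; clear hR; obtain ⟨v12, hv12, hR⟩ := htmp
    simp -failIfUnchanged (disch := omega) only [Operand.write, Operand.read, merge_apply_of_lt,
      merge_apply_of_le, Function.update_self, Function.update_of_ne, update_merge_of_lt,
      update_merge_of_le, Nat.add_zero, Nat.zero_add, BinOp.eval_mod, BinOp.eval_eq, BinOp.eval_band,
      BinOp.eval_shr, BinOp.eval_div, BinOp.eval_lt, BinOp.eval_add_of_lt, BinOp.eval_sub_of_le,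
      BinOp.eval_mul_of_lt, h2, h24, h25, h27, h60, h61, h62, h63, h64] at hv12 hR
    have hcx : H v12 ≤ BIGC := by rw [← hv12, Nat.add_comm]; exact hsrcv _ h11'
    have htmp := execOps_cons_fwd hR; clear hR; obtain ⟨v13, hv13, hR⟩ := htmp
    simp -failIfUnchanged (disch := omega) only [Operand.write, Operand.read, merge_apply_of_lt,
      merge_apply_of_le, Function.update_self, Function.update_of_ne, update_merge_of_lt,
      update_merge_of_le, Nat.add_zero, Nat.zero_add, BinOp.eval_mod, BinOp.eval_eq, BinOp.eval_band,
      BinOp.eval_shr, BinOp.eval_div, BinOp.eval_lt, BinOp.eval_add_of_lt, BinOp.eval_sub_of_le,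
      BinOp.eval_mul_of_lt, h2, h24, h25, h27, h60, h61, h62, h63, h64] at hv13 hR
    simp only [execOps_nil] at hR; subst hR
    subst hv13 hv12 hv11 hv10 hv9 hv8 hv7 hv6 hv5 hv4 hv3 hv2
    have hflag : ((if ro + r / L < n then 1 else 0) * if co + r % L < n then 1 else 0) =
        if ro + r / L < n ∧ co + r % L < n then 1 else 0 := by
      by_cases ha : ro + r / L < n <;> by_cases hb : co + r % L < n <;> simp [ha, hb]
    refine ⟨_, rfl, fun i h60' h65 h66 h67 h68 h69 h70 => ?_, ?_, ?_, ?_, ?_, ?_, ?_⟩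
    · simp only [Function.update_of_ne, ne_eq, not_false_eq_true, h60', h65, h66, h67, h68, h69, h70]
    · simp [Function.update_of_ne, Function.update_self]
    · simp [Function.update_of_ne, Function.update_self]
    · simp [Function.update_of_ne, Function.update_self]
    · simp only [Function.update_of_ne, Function.update_self, ne_eq, Nat.reduceEqDiff, not_false_eq_true]
      exact hflag
    · simp only [Function.update_of_ne, Function.update_self, ne_eq, Nat.reduceEqDiff, not_false_eq_true]
      rw [hflag]
      by_cases hc : ro + r / L < n ∧ co + r % L < n
      · rw [if_pos hc, if_pos hc, Nat.mul_one, Nat.add_comm]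
      · rw [if_neg hc, if_neg hc, Nat.mul_zero, Nat.zero_add]
    · simp only [Function.update_of_ne, Function.update_self, ne_eq, Nat.reduceEqDiff, not_false_eq_true]
      exact hcx
  have h24₁ : S₁ 24 = BIGC := (hS₁ 24 (by omega) (by omega) (by omega) (by omega) (by omega) (by omega) (by omega)).trans h24
  have h27₁ : S₁ 27 = L3 := (hS₁ 27 (by omega) (by omega) (by omega) (by omega) (by omega) (by omega) (by omega)).trans h27
  have h64₁ : S₁ 64 = dst := (hS₁ 64 (by omega) (by omega) (by omega) (by omega) (by omega) (by omega) (by omega)).trans h64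
  set f := (if ro + r / L < n ∧ co + r % L < n then 1 else 0) with hf
  set cx := (if ro + r / L < n ∧ co + r % L < n then H (src + ((ro + r / L) * n + (co + r % L))) else H src) with hcx
  have hf1 : f ≤ 1 := by rw [hf]; exact NegTriToAPSP.ite_le_one _
  -- block 2
  obtain ⟨st₂, hex₂, S₂, H₂, rfl, hS₂, hH₂⟩ : ∃ st₂, Exec w O (block blockCopyOps2)
      ⟨merge S₁ H, qs⟩ st₂ 10 ∧ ∃ S₂ H₂, st₂ = ⟨merge S₂ H₂, qs⟩ ∧
      (∀ i, i ≠ 67 → i ≠ 68 → i ≠ 69 → i ≠ 70 → S₂ i = S₁ i) ∧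
      H₂ = Function.update H (dst + r / L * L3 + r % L) (bcVal H n BIGC src ro co (r / L) (r % L)) := by
    refine Exec.block_of_fwd _ _ fun R hR => ?_
    unfold blockCopyOps2 at hR
    have htmp := execOps_cons_fwd hR; clear hR; obtain ⟨v1, hv1, hR⟩ := htmp
    simp -failIfUnchanged (disch := omega) only [Operand.write, Operand.read, merge_apply_of_lt,
      merge_apply_of_le, Function.update_self, Function.update_of_ne, update_merge_of_lt,
      update_merge_of_le, Nat.add_zero, Nat.zero_add, BinOp.eval_mod, BinOp.eval_eq, BinOp.eval_band,
      BinOp.eval_shr, BinOp.eval_div, BinOp.eval_lt, BinOp.eval_add_of_lt, BinOp.eval_sub_of_le,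
      BinOp.eval_mul_of_lt, h24₁, h27₁, h64₁, h65₁, h66₁, h68₁, h69₁] at hv1 hR
    have hv1' : v1 ≤ 1 := hv1 ▸ NegTriToAPSP.ite_le_one _
    have htmp := execOps_cons_fwd hR; clear hR; obtain ⟨v2, hv2, hR⟩ := htmp
    simp -failIfUnchanged (disch := omega) only [Operand.write, Operand.read, merge_apply_of_lt,
      merge_apply_of_le, Function.update_self, Function.update_of_ne, update_merge_of_lt,
      update_merge_of_le, Nat.add_zero, Nat.zero_add, BinOp.eval_mod, BinOp.eval_eq, BinOp.eval_band,
      BinOp.eval_shr, BinOp.eval_div, BinOp.eval_lt, BinOp.eval_add_of_lt, BinOp.eval_sub_of_le,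
      BinOp.eval_mul_of_lt, h24₁, h27₁, h64₁, h65₁, h66₁, h68₁, h69₁] at hv2 hR
    rw [band_bit hf1 hv1'] at hv2
    have hv2' : v2 ≤ 1 := hv2 ▸ mul_le_one' hf1 hv1'
    have h3 : cx * v2 ≤ cx := by simpa using Nat.mul_le_mul_left cx hv2'
    have htmp := execOps_cons_fwd hR; clear hR; obtain ⟨v3, hv3, hR⟩ := htmp
    simp -failIfUnchanged (disch := omega) only [Operand.write, Operand.read, merge_apply_of_lt,
      merge_apply_of_le, Function.update_self, Function.update_of_ne, update_merge_of_lt,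
      update_merge_of_le, Nat.add_zero, Nat.zero_add, BinOp.eval_mod, BinOp.eval_eq, BinOp.eval_band,
      BinOp.eval_shr, BinOp.eval_div, BinOp.eval_lt, BinOp.eval_add_of_lt, BinOp.eval_sub_of_le,
      BinOp.eval_mul_of_lt, h24₁, h27₁, h64₁, h65₁, h66₁, h68₁, h69₁] at hv3 hR
    have h4 : v2 * BIGC ≤ BIGC := by simpa using Nat.mul_le_mul_right BIGC hv2'
    have htmp := execOps_cons_fwd hR; clear hR; obtain ⟨v4, hv4, hR⟩ := htmp
    simp -failIfUnchanged (disch := omega) only [Operand.write, Operand.read, merge_apply_of_lt,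
      merge_apply_of_le, Function.update_self, Function.update_of_ne, update_merge_of_lt,
      update_merge_of_le, Nat.add_zero, Nat.zero_add, BinOp.eval_mod, BinOp.eval_eq, BinOp.eval_band,
      BinOp.eval_shr, BinOp.eval_div, BinOp.eval_lt, BinOp.eval_add_of_lt, BinOp.eval_sub_of_le,
      BinOp.eval_mul_of_lt, h24₁, h27₁, h64₁, h65₁, h66₁, h68₁, h69₁] at hv4 hR
    have htmp := execOps_cons_fwd hR; clear hR; obtain ⟨v5, hv5, hR⟩ := htmp
    simp -failIfUnchanged (disch := omega) only [Operand.write, Operand.read, merge_apply_of_lt,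
      merge_apply_of_le, Function.update_self, Function.update_of_ne, update_merge_of_lt,
      update_merge_of_le, Nat.add_zero, Nat.zero_add, BinOp.eval_mod, BinOp.eval_eq, BinOp.eval_band,
      BinOp.eval_shr, BinOp.eval_div, BinOp.eval_lt, BinOp.eval_add_of_lt, BinOp.eval_sub_of_le,
      BinOp.eval_mul_of_lt, h24₁, h27₁, h64₁, h65₁, h66₁, h68₁, h69₁] at hv5 hR
    have htmp := execOps_cons_fwd hR; clear hR; obtain ⟨v6, hv6, hR⟩ := htmp
    simp -failIfUnchanged (disch := omega) only [Operand.write, Operand.read, merge_apply_of_lt,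
      merge_apply_of_le, Function.update_self, Function.update_of_ne, update_merge_of_lt,
      update_merge_of_le, Nat.add_zero, Nat.zero_add, BinOp.eval_mod, BinOp.eval_eq, BinOp.eval_band,
      BinOp.eval_shr, BinOp.eval_div, BinOp.eval_lt, BinOp.eval_add_of_lt, BinOp.eval_sub_of_le,
      BinOp.eval_mul_of_lt, h24₁, h27₁, h64₁, h65₁, h66₁, h68₁, h69₁] at hv6 hR
    have h7 : r / L * L3 ≤ r / L * L3 + r % L := Nat.le_add_right _ _
    have htmp := execOps_cons_fwd hR; clear hR; obtain ⟨v7, hv7, hR⟩ := htmp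
    simp -failIfUnchanged (disch := omega) only [Operand.write, Operand.read, merge_apply_of_lt,
      merge_apply_of_le, Function.update_self, Function.update_of_ne, update_merge_of_lt,
      update_merge_of_le, Nat.add_zero, Nat.zero_add, BinOp.eval_mod, BinOp.eval_eq, BinOp.eval_band,
      BinOp.eval_shr, BinOp.eval_div, BinOp.eval_lt, BinOp.eval_add_of_lt, BinOp.eval_sub_of_le,
      BinOp.eval_mul_of_lt, h24₁, h27₁, h64₁, h65₁, h66₁, h68₁, h69₁] at hv7 hR
    have htmp := execOps_cons_fwd hR; clear hR; obtain ⟨v8, hv8, hR⟩ := htmp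
    simp -failIfUnchanged (disch := omega) only [Operand.write, Operand.read, merge_apply_of_lt,
      merge_apply_of_le, Function.update_self, Function.update_of_ne, update_merge_of_lt,
      update_merge_of_le, Nat.add_zero, Nat.zero_add, BinOp.eval_mod, BinOp.eval_eq, BinOp.eval_band,
      BinOp.eval_shr, BinOp.eval_div, BinOp.eval_lt, BinOp.eval_add_of_lt, BinOp.eval_sub_of_le,
      BinOp.eval_mul_of_lt, h24₁, h27₁, h64₁, h65₁, h66₁, h68₁, h69₁] at hv8 hR
    have htmp := execOps_cons_fwd hR; clear hR; obtain ⟨v9, hv9, hR⟩ := htmp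
    simp -failIfUnchanged (disch := omega) only [Operand.write, Operand.read, merge_apply_of_lt,
      merge_apply_of_le, Function.update_self, Function.update_of_ne, update_merge_of_lt,
      update_merge_of_le, Nat.add_zero, Nat.zero_add, BinOp.eval_mod, BinOp.eval_eq, BinOp.eval_band,
      BinOp.eval_shr, BinOp.eval_div, BinOp.eval_lt, BinOp.eval_add_of_lt, BinOp.eval_sub_of_le,
      BinOp.eval_mul_of_lt, h24₁, h27₁, h64₁, h65₁, h66₁, h68₁, h69₁] at hv9 hR
    have htmp := execOps_cons_fwd hR; clear hR; obtain ⟨v10, hv10, hR⟩ := htmp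
    simp -failIfUnchanged (disch := omega) only [Operand.write, Operand.read, merge_apply_of_lt,
      merge_apply_of_le, Function.update_self, Function.update_of_ne, update_merge_of_lt,
      update_merge_of_le, Nat.add_zero, Nat.zero_add, BinOp.eval_mod, BinOp.eval_eq, BinOp.eval_band,
      BinOp.eval_shr, BinOp.eval_div, BinOp.eval_lt, BinOp.eval_add_of_lt, BinOp.eval_sub_of_le,
      BinOp.eval_mul_of_lt, h24₁, h27₁, h64₁, h65₁, h66₁, h68₁, h69₁] at hv10 hR
    simp only [execOps_nil] at hR; subst hR
    subst hv10 hv9 hv8 hv7 hv6 hv5 hv4 hv3 hv2 hv1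
    refine ⟨_, _, rfl, fun i h67 h68 h69 h70 => ?_, ?_⟩
    · simp only [Function.update_of_ne, ne_eq, not_false_eq_true, h67, h68, h69, h70]
    · congr 1
      · ring
      · rw [hcx, hf, bcVal]
        by_cases hc : ro + r / L < n ∧ co + r % L < n
        · simp only [hc, and_self, if_true, true_and, Nat.one_mul]
          by_cases hz : H (src + ((ro + r / L) * n + (co + r % L))) = 0
          · simp [hz]
          · have hp : 0 < H (src + ((ro + r / L) * n + (co + r % L))) := Nat.pos_of_ne_zero hz
            simp [hz, hp]
        · rw [if_neg hc, if_neg hc, if_neg (c := ro + r / L < n ∧ co + r % L < n ∧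
            H (src + ((ro + r / L) * n + (co + r % L))) ≠ 0) (fun h => hc ⟨h.1, h.2.1⟩)]
          simp
  refine ⟨S₂, H₂, ?_, fun i h60 h65 h66 h67 h68 h69 h70 => ?_, ?_, hH₂⟩
  · have := hex₁.seqs_cons (Exec.seqs_one hex₂)
    exact this
  · rw [hS₂ i h67 h68 h69 h70, hS₁ i h60 h65 h66 h67 h68 h69 h70]
  · rw [hS₂ 60 (by omega) (by omega) (by omega) (by omega), h60₁]

/-- `bcVal` only reads the source block. [folklore] -/
theorem bcVal_congr {H H' : ℕ → ℕ} {n BIGC src ro co il kl : ℕ}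
    (h : ∀ t, t < n * n → H' (src + t) = H (src + t)) :
    bcVal H' n BIGC src ro co il kl = bcVal H n BIGC src ro co il kl := by
  unfold bcVal
  by_cases hc : ro + il < n ∧ co + kl < n
  · rw [h _ (NegTriToAPSP.mul_add_lt_mul hc.1 hc.2)]
  · rw [if_neg (fun h' => hc ⟨h'.1, h'.2.1⟩), if_neg (fun h' => hc ⟨h'.1, h'.2.1⟩)]

/-- Distinct entries of an `L × L3`-strided block have distinct addresses. [folklore] -/
theorem strided_inj {L L3 r r' : ℕ} (hL : 1 ≤ L) (hL3 : L ≤ L3)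
    (h : r / L * L3 + r % L = r' / L * L3 + r' % L) : r = r' := by
  have h1 : r % L < L := Nat.mod_lt _ (by omega)
  have h2 : r' % L < L := Nat.mod_lt _ (by omega)
  have hq : r / L = r' / L := by
    by_contra hne
    rcases Nat.lt_or_gt_of_ne hne with hlt | hlt
    · have : (r / L + 1) * L3 ≤ r' / L * L3 := Nat.mul_le_mul_right _ hlt
      rw [Nat.succ_mul] at this
      omega
    · have : (r' / L + 1) * L3 ≤ r / L * L3 := Nat.mul_le_mul_right _ hlt
      rw [Nat.succ_mul] at this
      omega
  have hm : r % L = r' % L := by rw [hq] at h; omega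
  rw [← Nat.div_add_mod r L, ← Nat.div_add_mod r' L, hq, hm]

/-- **Semantics of `blockCopy`.** With count `L²` in `r60`, source codes from `r61`, row and
column offsets `r62, r63 < n` and destination `r64` (a data address past the source block), the
loop writes, within `25 L² + 1` steps, the code `bcVal` of every block entry `(il, kl)` at
`dst + il L3 + kl`, leaves every other data cell and the registers outside `60, 65–70` intact,
and makes no query. [folklore] -/
theorem blockCopy_spec {w : ℕ} {O : List ℕ → List ℕ} {n L L3 BIGC src ro co dst : ℕ}
    {S H : ℕ → ℕ} {qs : List (List ℕ)}
    (h2 : S 2 = n) (h24 : S 24 = BIGC) (h25 : S 25 = L) (h27 : S 27 = L3) (h60 : S 60 = L * L)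
    (h61 : S 61 = src) (h62 : S 62 = ro) (h63 : S 63 = co) (h64 : S 64 = dst)
    (hn : 1 ≤ n) (hL : 1 ≤ L) (hL3 : L3 = 3 * L) (hro : ro < n) (hco : co < n)
    (hsrc : 100 ≤ src) (hdisj : src + n * n ≤ dst)
    (hsrcv : ∀ t, t < n * n → H (src + t) ≤ BIGC)
    (hcapB : 2 * BIGC < 2 ^ w) (hcapN : (n + L) * n + (n + L) < 2 ^ w)
    (hcapD : dst + L * L3 < 2 ^ w) :
    ∃ S' H', ExecLE w O blockCopy ⟨merge S H, qs⟩ ⟨merge S' H', qs⟩ (L * L * 25 + 1) ∧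
      (∀ i, i ≠ 60 → i ≠ 65 → i ≠ 66 → i ≠ 67 → i ≠ 68 → i ≠ 69 → i ≠ 70 → S' i = S i) ∧
      (∀ r, r < L * L → H' (dst + r / L * L3 + r % L) = bcVal H n BIGC src ro co (r / L) (r % L)) ∧
      (∀ a, (∀ r, r < L * L → a ≠ dst + r / L * L3 + r % L) → H' a = H a) := by
  have hdst : 100 ≤ dst := by nlinarith
  have hcapS : src + n * n < 2 ^ w := by
    have : L * 1 ≤ L * L3 := Nat.mul_le_mul_left _ (by omega)
    omega
  -- the invariant after `i` iterations: entries `r ≥ L² - i` written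
  obtain ⟨st', hex, S', H', rfl, hS', -, hw, hnw⟩ := ExecLE.whilenz_invariant (w := w) (O := O)
    (x := .dir 60) (s := seqs [block blockCopyOps1, block blockCopyOps2]) (L * L) 23
    (fun i st => ∃ S' H', st = ⟨merge S' H', qs⟩ ∧
      (∀ j, j ≠ 60 → j ≠ 65 → j ≠ 66 → j ≠ 67 → j ≠ 68 → j ≠ 69 → j ≠ 70 → S' j = S j) ∧
      S' 60 = L * L - i ∧
      (∀ r, L * L - i ≤ r → r < L * L →
        H' (dst + r / L * L3 + r % L) = bcVal H n BIGC src ro co (r / L) (r % L)) ∧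
      (∀ a, (∀ r, L * L - i ≤ r → r < L * L → a ≠ dst + r / L * L3 + r % L) → H' a = H a))
    (fun i hi st ⟨S', H', hst, hS', h60', hw, hnw⟩ => by
      subst hst
      refine ⟨by rw [Operand.read_dir_merge (by norm_num), h60']; omega, ?_⟩
      have hsrcEq : ∀ t, t < n * n → H' (src + t) = H (src + t) := fun t ht => by
        refine hnw (src + t) fun r _ hr => ?_
        have : r / L * L3 + r % L < L * L3 := div_mul_add_mod_lt hL hr (by omega)
        omega
      have hsrc' : ∀ t, t < n * n → H' (src + t) ≤ BIGC := fun t ht => by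
        rw [hsrcEq t ht]; exact hsrcv t ht
      obtain ⟨S'', H'', hex, hS'', h60'', hH''⟩ := blockCopy_iter (O := O) (qs := qs) (r := L * L - i - 1)
        ((hS' 2 (by omega) (by omega) (by omega) (by omega) (by omega) (by omega) (by omega)).trans h2)
        ((hS' 24 (by omega) (by omega) (by omega) (by omega) (by omega) (by omega) (by omega)).trans h24)
        ((hS' 25 (by omega) (by omega) (by omega) (by omega) (by omega) (by omega) (by omega)).trans h25)
        ((hS' 27 (by omega) (by omega) (by omega) (by omega) (by omega) (by omega) (by omega)).trans h27)
        (by rw [h60']; omega)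
        ((hS' 61 (by omega) (by omega) (by omega) (by omega) (by omega) (by omega) (by omega)).trans h61)
        ((hS' 62 (by omega) (by omega) (by omega) (by omega) (by omega) (by omega) (by omega)).trans h62)
        ((hS' 63 (by omega) (by omega) (by omega) (by omega) (by omega) (by omega) (by omega)).trans h63)
        ((hS' 64 (by omega) (by omega) (by omega) (by omega) (by omega) (by omega) (by omega)).trans h64)
        hn hL hL3 (by omega) hro hco hsrc hdst hsrc' hcapB hcapN hcapS hcapD
      refine ⟨_, hex.execLE, S'', H'', rfl, fun j a b c d e f g => ?_, by rw [h60'']; omega, ?_, ?_⟩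
      · rw [hS'' j a b c d e f g, hS' j a b c d e f g]
      · intro r hr1 hr2
        rw [hH'']
        rcases Nat.lt_or_ge r (L * L - i) with hlt | hge
        · have hr : r = L * L - i - 1 := by omega
          subst hr
          rw [Function.update_self]
          exact bcVal_congr hsrcEq
        · rw [Function.update_of_ne, hw r hge hr2]
          intro heq
          have := strided_inj (r := r) (r' := L * L - i - 1) hL (show L ≤ L3 by omega) (by omega)
          omega
      · intro a ha
        rw [hH'', Function.update_of_ne (ha _ (by omega) (by omega)), hnw a fun r hr1 hr2 => ha r (by omega) hr2])
    (fun st ⟨S', H', hst, _, h60', _⟩ => by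
      subst hst; rw [Operand.read_dir_merge (by norm_num), h60']; omega)
    ⟨S, H, rfl, fun j _ _ _ _ _ _ _ => rfl, by rw [h60]; rfl, fun r h1 h2 => by omega, fun a _ => rfl⟩
  refine ⟨S', H', ?_, hS', fun r hr => hw r (by omega) hr, fun a ha => hnw a fun r _ hr => ha r hr⟩
  unfold blockCopy
  convert hex using 1

end Literature.Computability.FineGrained.NegTriSweep

namespace Literature.Computability.FineGrained.NegTriSweep

open Cryptography Cryptography.WordRAM Cryptography.WordRAM.SProg APSPPower NegTriStep

set_option linter.unusedSimpArgs false


/-! ## `buildT`: one iteration -/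

/-- `zzCode A B ≤ 2 (A + B) + 1`. [folklore] -/
theorem zzCode_le (A B : ℕ) : zzCode A B ≤ 2 * (A + B) + 1 := by
  unfold zzCode; split_ifs <;> omega

/-- One iteration of `buildT`: the back arc of entry `r` (`iu = r / L`, `iv = r % L`). [folklore] -/
theorem buildT_iter {w : ℕ} {O : List ℕ → List ℕ}
    {n F FDB M2 BIGC pw L L3 TB bi bj nfr rsel nfc csel r : ℕ} {S H : ℕ → ℕ} {qs : List (List ℕ)}
    (h2 : S 2 = n) (h9 : S 9 = F) (h19 : S 19 = M2 + 1) (h22 : S 22 = M2) (h24 : S 24 = BIGC)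
    (h25 : S 25 = L) (h27 : S 27 = L3) (h30 : S 30 = FDB) (h38 : S 38 = TB) (h40 : S 40 = pw)
    (h42 : S 42 = bi) (h43 : S 43 = bj) (h46 : S 46 = nfr) (h47 : S 47 = rsel) (h48 : S 48 = nfc)
    (h49 : S 49 = csel) (h50 : S 50 = r + 1)
    (hn : 1 ≤ n) (hL : 1 ≤ L) (hL3 : L3 = 3 * L) (hr : r < L * L) (hbi : bi * L < n) (hbj : bj * L < n)
    (hnfr : nfr ≤ 1) (hnfc : nfc ≤ 1) (hF : 100 ≤ F) (hFDB : FDB = F + n * n) (hTB : FDB + n * n ≤ TB)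
    (hBIG : BIGC = 16 * M2 + 9) (hpw : 1 ≤ pw)
    (hlo : ∀ t, t < n * n → H (F + t) + pw ≤ 4 * M2 + 2) (hfd : ∀ t, t < n * n → H (FDB + t) < 2 ^ w)
    (hcapB : 2 * BIGC < 2 ^ w) (hcapN : (n + L) * n + (n + L) < 2 ^ w) (hcapT : TB + L * L3 < 2 ^ w) :
    ∃ S' H', Exec w O (seqs [block buildTOps1, block buildTOps2, block buildTOps3]) ⟨merge S H, qs⟩
        ⟨merge S' H', qs⟩ 44 ∧
      (∀ i, i < 50 ∨ 59 < i → S' i = S i) ∧ S' 50 = r ∧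
      H' = Function.update H (TB + r / L * L3 + r % L)
        (tbVal H n F FDB M2 BIGC pw L bi bj nfr rsel nfc csel (r / L) (r % L)) := by
  have hiu : r / L < L := Nat.div_lt_of_lt_mul hr
  have hiv : r % L < L := Nat.mod_lt _ (by omega)
  have hoff : r / L * L3 + r % L < L * L3 := div_mul_add_mod_lt hL hr (by omega)
  have hLL3 : L * L ≤ L * L3 := Nat.mul_le_mul_left _ (by omega)
  have hpw2 : pw < 2 ^ w := by have := hlo 0 (Nat.mul_pos hn hn); omega
  set iu := r / L with hiu_def
  set iv := r % L with hiv_def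
  set idx := (bi * L + iv) * n + (bj * L + iu) with hidx
  -- block 1: indices and the range/window flag
  obtain ⟨st₁, hex₁, S₁, rfl, hS₁, h50₁, h51₁, h52₁, h53₁, h54₁, h55₁⟩ : ∃ st₁, Exec w O (block buildTOps1)
      ⟨merge S H, qs⟩ st₁ 16 ∧ ∃ S₁, st₁ = ⟨merge S₁ H, qs⟩ ∧
      (∀ i, i < 50 ∨ 59 < i → S₁ i = S i) ∧ S₁ 50 = r ∧ S₁ 51 = iu ∧ S₁ 52 = iv ∧
      S₁ 53 = bi * L + iv ∧ S₁ 54 = bj * L + iu ∧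
      S₁ 55 = (if bi * L + iv < n ∧ bj * L + iu < n ∧ iv * nfr = rsel ∧ iu * nfc = csel then 1 else 0) := by
    refine Exec.block_of_fwd _ _ fun R hR => ?_
    unfold buildTOps1 at hR
    have htmp := execOps_cons_fwd hR; clear hR; obtain ⟨v1, hv1, hR⟩ := htmp
    simp -failIfUnchanged (disch := omega) only [Operand.write, Operand.read, merge_apply_of_lt,
      merge_apply_of_le, Function.update_self, Function.update_of_ne, update_merge_of_lt,
      update_merge_of_le, Nat.add_zero, Nat.zero_add, BinOp.eval_mod, BinOp.eval_eq, BinOp.eval_band,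
      BinOp.eval_shr, BinOp.eval_div, BinOp.eval_lt, BinOp.eval_add_of_lt, BinOp.eval_sub_of_le,
      BinOp.eval_mul_of_lt, h2, h25, h42, h43, h46, h47, h48, h49, h50] at hv1 hR
    simp only [Nat.add_sub_cancel] at hv1; subst hv1
    have htmp := execOps_cons_fwd hR; clear hR; obtain ⟨v2, hv2, hR⟩ := htmp
    simp -failIfUnchanged (disch := omega) only [Operand.write, Operand.read, merge_apply_of_lt,
      merge_apply_of_le, Function.update_self, Function.update_of_ne, update_merge_of_lt,
      update_merge_of_le, Nat.add_zero, Nat.zero_add, BinOp.eval_mod, BinOp.eval_eq, BinOp.eval_band,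
      BinOp.eval_shr, BinOp.eval_div, BinOp.eval_lt, BinOp.eval_add_of_lt, BinOp.eval_sub_of_le,
      BinOp.eval_mul_of_lt, h2, h25, h42, h43, h46, h47, h48, h49, h50] at hv2 hR
    rw [← hiu_def] at hv2; subst hv2
    have htmp := execOps_cons_fwd hR; clear hR; obtain ⟨v3, hv3, hR⟩ := htmp
    simp -failIfUnchanged (disch := omega) only [Operand.write, Operand.read, merge_apply_of_lt,
      merge_apply_of_le, Function.update_self, Function.update_of_ne, update_merge_of_lt,
      update_merge_of_le, Nat.add_zero, Nat.zero_add, BinOp.eval_mod, BinOp.eval_eq, BinOp.eval_band,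
      BinOp.eval_shr, BinOp.eval_div, BinOp.eval_lt, BinOp.eval_add_of_lt, BinOp.eval_sub_of_le,
      BinOp.eval_mul_of_lt, h2, h25, h42, h43, h46, h47, h48, h49, h50] at hv3 hR
    rw [← hiv_def] at hv3; subst hv3
    have htmp := execOps_cons_fwd hR; clear hR; obtain ⟨v4, hv4, hR⟩ := htmp
    simp -failIfUnchanged (disch := omega) only [Operand.write, Operand.read, merge_apply_of_lt,
      merge_apply_of_le, Function.update_self, Function.update_of_ne, update_merge_of_lt,
      update_merge_of_le, Nat.add_zero, Nat.zero_add, BinOp.eval_mod, BinOp.eval_eq, BinOp.eval_band,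
      BinOp.eval_shr, BinOp.eval_div, BinOp.eval_lt, BinOp.eval_add_of_lt, BinOp.eval_sub_of_le,
      BinOp.eval_mul_of_lt, h2, h25, h42, h43, h46, h47, h48, h49, h50] at hv4 hR
    have htmp := execOps_cons_fwd hR; clear hR; obtain ⟨v5, hv5, hR⟩ := htmp
    simp -failIfUnchanged (disch := omega) only [Operand.write, Operand.read, merge_apply_of_lt,
      merge_apply_of_le, Function.update_self, Function.update_of_ne, update_merge_of_lt,
      update_merge_of_le, Nat.add_zero, Nat.zero_add, BinOp.eval_mod, BinOp.eval_eq, BinOp.eval_band,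
      BinOp.eval_shr, BinOp.eval_div, BinOp.eval_lt, BinOp.eval_add_of_lt, BinOp.eval_sub_of_le,
      BinOp.eval_mul_of_lt, h2, h25, h42, h43, h46, h47, h48, h49, h50] at hv5 hR
    have htmp := execOps_cons_fwd hR; clear hR; obtain ⟨v6, hv6, hR⟩ := htmp
    simp -failIfUnchanged (disch := omega) only [Operand.write, Operand.read, merge_apply_of_lt,
      merge_apply_of_le, Function.update_self, Function.update_of_ne, update_merge_of_lt,
      update_merge_of_le, Nat.add_zero, Nat.zero_add, BinOp.eval_mod, BinOp.eval_eq, BinOp.eval_band,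
      BinOp.eval_shr, BinOp.eval_div, BinOp.eval_lt, BinOp.eval_add_of_lt, BinOp.eval_sub_of_le,
      BinOp.eval_mul_of_lt, h2, h25, h42, h43, h46, h47, h48, h49, h50] at hv6 hR
    have htmp := execOps_cons_fwd hR; clear hR; obtain ⟨v7, hv7, hR⟩ := htmp
    simp -failIfUnchanged (disch := omega) only [Operand.write, Operand.read, merge_apply_of_lt,
      merge_apply_of_le, Function.update_self, Function.update_of_ne, update_merge_of_lt,
      update_merge_of_le, Nat.add_zero, Nat.zero_add, BinOp.eval_mod, BinOp.eval_eq, BinOp.eval_band,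
      BinOp.eval_shr, BinOp.eval_div, BinOp.eval_lt, BinOp.eval_add_of_lt, BinOp.eval_sub_of_le,
      BinOp.eval_mul_of_lt, h2, h25, h42, h43, h46, h47, h48, h49, h50] at hv7 hR
    have htmp := execOps_cons_fwd hR; clear hR; obtain ⟨v8, hv8, hR⟩ := htmp
    simp -failIfUnchanged (disch := omega) only [Operand.write, Operand.read, merge_apply_of_lt,
      merge_apply_of_le, Function.update_self, Function.update_of_ne, update_merge_of_lt,
      update_merge_of_le, Nat.add_zero, Nat.zero_add, BinOp.eval_mod, BinOp.eval_eq, BinOp.eval_band,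
      BinOp.eval_shr, BinOp.eval_div, BinOp.eval_lt, BinOp.eval_add_of_lt, BinOp.eval_sub_of_le,
      BinOp.eval_mul_of_lt, h2, h25, h42, h43, h46, h47, h48, h49, h50] at hv8 hR
    have hv8' : v8 ≤ 1 := hv8 ▸ NegTriToAPSP.ite_le_one _
    have htmp := execOps_cons_fwd hR; clear hR; obtain ⟨v9, hv9, hR⟩ := htmp
    simp -failIfUnchanged (disch := omega) only [Operand.write, Operand.read, merge_apply_of_lt,
      merge_apply_of_le, Function.update_self, Function.update_of_ne, update_merge_of_lt,
      update_merge_of_le, Nat.add_zero, Nat.zero_add, BinOp.eval_mod, BinOp.eval_eq, BinOp.eval_band,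
      BinOp.eval_shr, BinOp.eval_div, BinOp.eval_lt, BinOp.eval_add_of_lt, BinOp.eval_sub_of_le,
      BinOp.eval_mul_of_lt, h2, h25, h42, h43, h46, h47, h48, h49, h50] at hv9 hR
    have hv9' : v9 ≤ 1 := hv9 ▸ NegTriToAPSP.ite_le_one _
    have htmp := execOps_cons_fwd hR; clear hR; obtain ⟨v10, hv10, hR⟩ := htmp
    simp -failIfUnchanged (disch := omega) only [Operand.write, Operand.read, merge_apply_of_lt,
      merge_apply_of_le, Function.update_self, Function.update_of_ne, update_merge_of_lt,
      update_merge_of_le, Nat.add_zero, Nat.zero_add, BinOp.eval_mod, BinOp.eval_eq, BinOp.eval_band,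
      BinOp.eval_shr, BinOp.eval_div, BinOp.eval_lt, BinOp.eval_add_of_lt, BinOp.eval_sub_of_le,
      BinOp.eval_mul_of_lt, h2, h25, h42, h43, h46, h47, h48, h49, h50] at hv10 hR
    rw [band_bit hv8' hv9'] at hv10
    have hv10' : v10 ≤ 1 := hv10 ▸ mul_le_one' hv8' hv9'
    have h11 : iv * nfr ≤ iv := by simpa using Nat.mul_le_mul_left iv hnfr
    have htmp := execOps_cons_fwd hR; clear hR; obtain ⟨v11, hv11, hR⟩ := htmp
    simp -failIfUnchanged (disch := omega) only [Operand.write, Operand.read, merge_apply_of_lt,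
      merge_apply_of_le, Function.update_self, Function.update_of_ne, update_merge_of_lt,
      update_merge_of_le, Nat.add_zero, Nat.zero_add, BinOp.eval_mod, BinOp.eval_eq, BinOp.eval_band,
      BinOp.eval_shr, BinOp.eval_div, BinOp.eval_lt, BinOp.eval_add_of_lt, BinOp.eval_sub_of_le,
      BinOp.eval_mul_of_lt, h2, h25, h42, h43, h46, h47, h48, h49, h50] at hv11 hR
    have htmp := execOps_cons_fwd hR; clear hR; obtain ⟨v12, hv12, hR⟩ := htmp
    simp -failIfUnchanged (disch := omega) only [Operand.write, Operand.read, merge_apply_of_lt,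
      merge_apply_of_le, Function.update_self, Function.update_of_ne, update_merge_of_lt,
      update_merge_of_le, Nat.add_zero, Nat.zero_add, BinOp.eval_mod, BinOp.eval_eq, BinOp.eval_band,
      BinOp.eval_shr, BinOp.eval_div, BinOp.eval_lt, BinOp.eval_add_of_lt, BinOp.eval_sub_of_le,
      BinOp.eval_mul_of_lt, h2, h25, h42, h43, h46, h47, h48, h49, h50] at hv12 hR
    have hv12' : v12 ≤ 1 := hv12 ▸ NegTriToAPSP.ite_le_one _
    have htmp := execOps_cons_fwd hR; clear hR; obtain ⟨v13, hv13, hR⟩ := htmp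
    simp -failIfUnchanged (disch := omega) only [Operand.write, Operand.read, merge_apply_of_lt,
      merge_apply_of_le, Function.update_self, Function.update_of_ne, update_merge_of_lt,
      update_merge_of_le, Nat.add_zero, Nat.zero_add, BinOp.eval_mod, BinOp.eval_eq, BinOp.eval_band,
      BinOp.eval_shr, BinOp.eval_div, BinOp.eval_lt, BinOp.eval_add_of_lt, BinOp.eval_sub_of_le,
      BinOp.eval_mul_of_lt, h2, h25, h42, h43, h46, h47, h48, h49, h50] at hv13 hR
    rw [band_bit hv10' hv12'] at hv13
    have hv13' : v13 ≤ 1 := hv13 ▸ mul_le_one' hv10' hv12'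
    have h14 : iu * nfc ≤ iu := by simpa using Nat.mul_le_mul_left iu hnfc
    have htmp := execOps_cons_fwd hR; clear hR; obtain ⟨v14, hv14, hR⟩ := htmp
    simp -failIfUnchanged (disch := omega) only [Operand.write, Operand.read, merge_apply_of_lt,
      merge_apply_of_le, Function.update_self, Function.update_of_ne, update_merge_of_lt,
      update_merge_of_le, Nat.add_zero, Nat.zero_add, BinOp.eval_mod, BinOp.eval_eq, BinOp.eval_band,
      BinOp.eval_shr, BinOp.eval_div, BinOp.eval_lt, BinOp.eval_add_of_lt, BinOp.eval_sub_of_le,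
      BinOp.eval_mul_of_lt, h2, h25, h42, h43, h46, h47, h48, h49, h50] at hv14 hR
    have htmp := execOps_cons_fwd hR; clear hR; obtain ⟨v15, hv15, hR⟩ := htmp
    simp -failIfUnchanged (disch := omega) only [Operand.write, Operand.read, merge_apply_of_lt,
      merge_apply_of_le, Function.update_self, Function.update_of_ne, update_merge_of_lt,
      update_merge_of_le, Nat.add_zero, Nat.zero_add, BinOp.eval_mod, BinOp.eval_eq, BinOp.eval_band,
      BinOp.eval_shr, BinOp.eval_div, BinOp.eval_lt, BinOp.eval_add_of_lt, BinOp.eval_sub_of_le,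
      BinOp.eval_mul_of_lt, h2, h25, h42, h43, h46, h47, h48, h49, h50] at hv15 hR
    have hv15' : v15 ≤ 1 := hv15 ▸ NegTriToAPSP.ite_le_one _
    have htmp := execOps_cons_fwd hR; clear hR; obtain ⟨v16, hv16, hR⟩ := htmp
    simp -failIfUnchanged (disch := omega) only [Operand.write, Operand.read, merge_apply_of_lt,
      merge_apply_of_le, Function.update_self, Function.update_of_ne, update_merge_of_lt,
      update_merge_of_le, Nat.add_zero, Nat.zero_add, BinOp.eval_mod, BinOp.eval_eq, BinOp.eval_band,
      BinOp.eval_shr, BinOp.eval_div, BinOp.eval_lt, BinOp.eval_add_of_lt, BinOp.eval_sub_of_le,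
      BinOp.eval_mul_of_lt, h2, h25, h42, h43, h46, h47, h48, h49, h50] at hv16 hR
    rw [band_bit hv13' hv15'] at hv16
    simp only [execOps_nil] at hR; subst hR
    subst hv16 hv15 hv14 hv13 hv12 hv11 hv10 hv9 hv8 hv7 hv6 hv5 hv4
    refine ⟨_, rfl, fun i hi => ?_, ?_, ?_, ?_, ?_, ?_, ?_⟩
    · rcases hi with hi | hi <;> simp only [Function.update_of_ne, ne_eq, not_false_eq_true,
        show i ≠ 50 by omega, show i ≠ 51 by omega, show i ≠ 52 by omega, show i ≠ 53 by omega,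
        show i ≠ 54 by omega, show i ≠ 55 by omega, show i ≠ 56 by omega]
    · simp [Function.update_of_ne, Function.update_self]
    · simp [Function.update_of_ne, Function.update_self]
    · simp [Function.update_of_ne, Function.update_self]
    · simp [Function.update_of_ne, Function.update_self]
    · simp [Function.update_of_ne, Function.update_self]
    · simp only [Function.update_of_ne, Function.update_self, ne_eq, Nat.reduceEqDiff, not_false_eq_true]
      by_cases ha : bi * L + iv < n <;> by_cases hb : bj * L + iu < n <;>
        by_cases hc : iv * nfr = rsel <;> by_cases hd : iu * nfc = csel <;> simp [ha, hb, hc, hd]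
  have h2₁ : S₁ 2 = n := (hS₁ 2 (by omega)).trans h2
  have h9₁ : S₁ 9 = F := (hS₁ 9 (by omega)).trans h9
  have h30₁ : S₁ 30 = FDB := (hS₁ 30 (by omega)).trans h30
  have h40₁ : S₁ 40 = pw := (hS₁ 40 (by omega)).trans h40
  set f₁ := (if bi * L + iv < n ∧ bj * L + iu < n ∧ iv * nfr = rsel ∧ iu * nfc = csel then 1 else 0) with hf₁
  have hf₁1 : f₁ ≤ 1 := by rw [hf₁]; exact NegTriToAPSP.ite_le_one _
  have hidxf : f₁ * idx < n * n := by
    rw [hf₁]; split_ifs with hc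
    · rw [Nat.one_mul]; exact NegTriToAPSP.mul_add_lt_mul hc.1 hc.2.1
    · rw [Nat.zero_mul]; exact Nat.mul_pos hn hn
  -- block 2: the found flag and the threshold
  obtain ⟨st₂, hex₂, S₂, rfl, hS₂, h53₂', h55₂, h56₂⟩ : ∃ st₂, Exec w O (block buildTOps2)
      ⟨merge S₁ H, qs⟩ st₂ 9 ∧ ∃ S₂, st₂ = ⟨merge S₂ H, qs⟩ ∧
      (∀ i, i ≠ 53 → i ≠ 54 → i ≠ 55 → i ≠ 56 → S₂ i = S₁ i) ∧ S₂ 53 = f₁ * idx ∧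
      S₂ 55 = (if (bi * L + iv < n ∧ bj * L + iu < n ∧ iv * nfr = rsel ∧ iu * nfc = csel) ∧
        H (FDB + f₁ * idx) ≠ pw then 1 else 0) ∧
      S₂ 56 = H (F + f₁ * idx) + pw := by
    refine Exec.block_of_fwd _ _ fun R hR => ?_
    unfold buildTOps2 at hR
    have hp1 : (bi * L + iv) * n ≤ (n + L) * n := Nat.mul_le_mul_right _ (by omega)
    have htmp := execOps_cons_fwd hR; clear hR; obtain ⟨v1, hv1, hR⟩ := htmp
    simp -failIfUnchanged (disch := omega) only [Operand.write, Operand.read, merge_apply_of_lt,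
      merge_apply_of_le, Function.update_self, Function.update_of_ne, update_merge_of_lt,
      update_merge_of_le, Nat.add_zero, Nat.zero_add, BinOp.eval_mod, BinOp.eval_eq, BinOp.eval_band,
      BinOp.eval_shr, BinOp.eval_div, BinOp.eval_lt, BinOp.eval_add_of_lt, BinOp.eval_sub_of_le,
      BinOp.eval_mul_of_lt, h2₁, h9₁, h30₁, h40₁, h53₁, h54₁, h55₁] at hv1 hR
    have htmp := execOps_cons_fwd hR; clear hR; obtain ⟨v2, hv2, hR⟩ := htmp
    simp -failIfUnchanged (disch := omega) only [Operand.write, Operand.read, merge_apply_of_lt,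
      merge_apply_of_le, Function.update_self, Function.update_of_ne, update_merge_of_lt,
      update_merge_of_le, Nat.add_zero, Nat.zero_add, BinOp.eval_mod, BinOp.eval_eq, BinOp.eval_band,
      BinOp.eval_shr, BinOp.eval_div, BinOp.eval_lt, BinOp.eval_add_of_lt, BinOp.eval_sub_of_le,
      BinOp.eval_mul_of_lt, h2₁, h9₁, h30₁, h40₁, h53₁, h54₁, h55₁] at hv2 hR
    have hv2i : v2 = idx := by rw [← hv2, ← hv1]
    have h3 : v2 * f₁ < n * n := by rw [hv2i, Nat.mul_comm]; exact hidxf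
    have htmp := execOps_cons_fwd hR; clear hR; obtain ⟨v3, hv3, hR⟩ := htmp
    simp -failIfUnchanged (disch := omega) only [Operand.write, Operand.read, merge_apply_of_lt,
      merge_apply_of_le, Function.update_self, Function.update_of_ne, update_merge_of_lt,
      update_merge_of_le, Nat.add_zero, Nat.zero_add, BinOp.eval_mod, BinOp.eval_eq, BinOp.eval_band,
      BinOp.eval_shr, BinOp.eval_div, BinOp.eval_lt, BinOp.eval_add_of_lt, BinOp.eval_sub_of_le,
      BinOp.eval_mul_of_lt, h2₁, h9₁, h30₁, h40₁, h53₁, h54₁, h55₁] at hv3 hR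
    have htmp := execOps_cons_fwd hR; clear hR; obtain ⟨v4, hv4, hR⟩ := htmp
    simp -failIfUnchanged (disch := omega) only [Operand.write, Operand.read, merge_apply_of_lt,
      merge_apply_of_le, Function.update_self, Function.update_of_ne, update_merge_of_lt,
      update_merge_of_le, Nat.add_zero, Nat.zero_add, BinOp.eval_mod, BinOp.eval_eq, BinOp.eval_band,
      BinOp.eval_shr, BinOp.eval_div, BinOp.eval_lt, BinOp.eval_add_of_lt, BinOp.eval_sub_of_le,
      BinOp.eval_mul_of_lt, h2₁, h9₁, h30₁, h40₁, h53₁, h54₁, h55₁] at hv4 hR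
    have hfdv : H v4 < 2 ^ w := by rw [← hv4]; exact hfd _ (hv3 ▸ h3)
    have htmp := execOps_cons_fwd hR; clear hR; obtain ⟨v5, hv5, hR⟩ := htmp
    simp -failIfUnchanged (disch := omega) only [Operand.write, Operand.read, merge_apply_of_lt,
      merge_apply_of_le, Function.update_self, Function.update_of_ne, update_merge_of_lt,
      update_merge_of_le, Nat.add_zero, Nat.zero_add, BinOp.eval_mod, BinOp.eval_eq, BinOp.eval_band,
      BinOp.eval_shr, BinOp.eval_div, BinOp.eval_lt, BinOp.eval_add_of_lt, BinOp.eval_sub_of_le,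
      BinOp.eval_mul_of_lt, h2₁, h9₁, h30₁, h40₁, h53₁, h54₁, h55₁] at hv5 hR
    have htmp := execOps_cons_fwd hR; clear hR; obtain ⟨v6, hv6, hR⟩ := htmp
    simp -failIfUnchanged (disch := omega) only [Operand.write, Operand.read, merge_apply_of_lt,
      merge_apply_of_le, Function.update_self, Function.update_of_ne, update_merge_of_lt,
      update_merge_of_le, Nat.add_zero, Nat.zero_add, BinOp.eval_mod, BinOp.eval_eq, BinOp.eval_band,
      BinOp.eval_shr, BinOp.eval_div, BinOp.eval_lt, BinOp.eval_add_of_lt, BinOp.eval_sub_of_le,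
      BinOp.eval_mul_of_lt, h2₁, h9₁, h30₁, h40₁, h53₁, h54₁, h55₁] at hv6 hR
    rw [← hv5, flag_sub_ne hfdv hpw2] at hv6
    have hv6' : v6 ≤ 1 := by rw [← hv6]; split_ifs <;> omega
    have htmp := execOps_cons_fwd hR; clear hR; obtain ⟨v7, hv7, hR⟩ := htmp
    simp -failIfUnchanged (disch := omega) only [Operand.write, Operand.read, merge_apply_of_lt,
      merge_apply_of_le, Function.update_self, Function.update_of_ne, update_merge_of_lt,
      update_merge_of_le, Nat.add_zero, Nat.zero_add, BinOp.eval_mod, BinOp.eval_eq, BinOp.eval_band,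
      BinOp.eval_shr, BinOp.eval_div, BinOp.eval_lt, BinOp.eval_add_of_lt, BinOp.eval_sub_of_le,
      BinOp.eval_mul_of_lt, h2₁, h9₁, h30₁, h40₁, h53₁, h54₁, h55₁] at hv7 hR
    rw [band_bit hf₁1 hv6'] at hv7
    have htmp := execOps_cons_fwd hR; clear hR; obtain ⟨v8, hv8, hR⟩ := htmp
    simp -failIfUnchanged (disch := omega) only [Operand.write, Operand.read, merge_apply_of_lt,
      merge_apply_of_le, Function.update_self, Function.update_of_ne, update_merge_of_lt,
      update_merge_of_le, Nat.add_zero, Nat.zero_add, BinOp.eval_mod, BinOp.eval_eq, BinOp.eval_band,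
      BinOp.eval_shr, BinOp.eval_div, BinOp.eval_lt, BinOp.eval_add_of_lt, BinOp.eval_sub_of_le,
      BinOp.eval_mul_of_lt, h2₁, h9₁, h30₁, h40₁, h53₁, h54₁, h55₁] at hv8 hR
    have hlov : H v8 + pw ≤ 4 * M2 + 2 := by rw [← hv8]; exact hlo _ (hv3 ▸ h3)
    have htmp := execOps_cons_fwd hR; clear hR; obtain ⟨v9, hv9, hR⟩ := htmp
    simp -failIfUnchanged (disch := omega) only [Operand.write, Operand.read, merge_apply_of_lt,
      merge_apply_of_le, Function.update_self, Function.update_of_ne, update_merge_of_lt,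
      update_merge_of_le, Nat.add_zero, Nat.zero_add, BinOp.eval_mod, BinOp.eval_eq, BinOp.eval_band,
      BinOp.eval_shr, BinOp.eval_div, BinOp.eval_lt, BinOp.eval_add_of_lt, BinOp.eval_sub_of_le,
      BinOp.eval_mul_of_lt, h2₁, h9₁, h30₁, h40₁, h53₁, h54₁, h55₁] at hv9 hR
    simp only [execOps_nil] at hR; subst hR
    subst hv9 hv8 hv7 hv6 hv4 hv3
    refine ⟨_, rfl, fun i h53 h54 h55 h56 => ?_, ?_, ?_, ?_⟩
    · simp only [Function.update_of_ne, ne_eq, not_false_eq_true, h53, h54, h55, h56]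
    · simp only [Function.update_of_ne, Function.update_self, ne_eq, Nat.reduceEqDiff, not_false_eq_true]
      rw [hv2i, Nat.mul_comm]
    · simp only [Function.update_of_ne, Function.update_self, ne_eq, Nat.reduceEqDiff, not_false_eq_true]
      rw [hv2i, Nat.mul_comm idx, hf₁]
      by_cases hc : bi * L + iv < n ∧ bj * L + iu < n ∧ iv * nfr = rsel ∧ iu * nfc = csel
      · simp only [hc, if_true, true_and, Nat.one_mul]
        by_cases he : H (FDB + 1 * idx) = pw
        · rw [Nat.one_mul] at he; simp [he]
        · rw [Nat.one_mul] at he; simp [he]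
      · simp only [hc, if_false, false_and, Nat.zero_mul]
    · simp only [Function.update_of_ne, Function.update_self, ne_eq, Nat.reduceEqDiff, not_false_eq_true]
      rw [hv2i, Nat.mul_comm]
  have h19₂ : S₂ 19 = M2 + 1 := ((hS₂ 19 (by omega) (by omega) (by omega) (by omega)).trans (hS₁ 19 (by omega))).trans h19
  have h22₂ : S₂ 22 = M2 := ((hS₂ 22 (by omega) (by omega) (by omega) (by omega)).trans (hS₁ 22 (by omega))).trans h22
  have h24₂ : S₂ 24 = BIGC := ((hS₂ 24 (by omega) (by omega) (by omega) (by omega)).trans (hS₁ 24 (by omega))).trans h24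
  have h27₂ : S₂ 27 = L3 := ((hS₂ 27 (by omega) (by omega) (by omega) (by omega)).trans (hS₁ 27 (by omega))).trans h27
  have h38₂ : S₂ 38 = TB := ((hS₂ 38 (by omega) (by omega) (by omega) (by omega)).trans (hS₁ 38 (by omega))).trans h38
  have h51₂ : S₂ 51 = iu := (hS₂ 51 (by omega) (by omega) (by omega) (by omega)).trans h51₁
  have h52₂ : S₂ 52 = iv := (hS₂ 52 (by omega) (by omega) (by omega) (by omega)).trans h52₁
  set f := (if (bi * L + iv < n ∧ bj * L + iu < n ∧ iv * nfr = rsel ∧ iu * nfc = csel) ∧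
        H (FDB + f₁ * idx) ≠ pw then 1 else 0) with hf
  have hf1 : f ≤ 1 := by rw [hf]; exact NegTriToAPSP.ite_le_one _
  set sv := H (F + f₁ * idx) + pw with hsv
  have hsvB : sv ≤ 4 * M2 + 2 := hlo _ hidxf
  -- block 3: the code of the back arc
  obtain ⟨st₃, hex₃, S₃, H₃, rfl, hS₃, hH₃⟩ : ∃ st₃, Exec w O (block buildTOps3)
      ⟨merge S₂ H, qs⟩ st₃ 19 ∧ ∃ S₃ H₃, st₃ = ⟨merge S₃ H₃, qs⟩ ∧
      (∀ i, i ≠ 53 → i ≠ 54 → i ≠ 57 → i ≠ 58 → i ≠ 59 → S₃ i = S₂ i) ∧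
      H₃ = Function.update H (TB + iu * L3 + iv) (f * zzCode M2 sv + (BIGC - f * BIGC)) := by
    refine Exec.block_of_fwd _ _ fun R hR => ?_
    unfold buildTOps3 at hR
    have htmp := execOps_cons_fwd hR; clear hR; obtain ⟨v1, hv1, hR⟩ := htmp
    simp -failIfUnchanged (disch := omega) only [Operand.write, Operand.read, merge_apply_of_lt,
      merge_apply_of_le, Function.update_self, Function.update_of_ne, update_merge_of_lt,
      update_merge_of_le, Nat.add_zero, Nat.zero_add, BinOp.eval_mod, BinOp.eval_eq, BinOp.eval_band,
      BinOp.eval_shr, BinOp.eval_div, BinOp.eval_lt, BinOp.eval_add_of_lt, BinOp.eval_sub_of_le,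
      BinOp.eval_mul_of_lt, h19₂, h22₂, h24₂, h27₂, h38₂, h51₂, h52₂, h55₂, h56₂] at hv1 hR
    have hv1' : v1 ≤ 1 := hv1 ▸ NegTriToAPSP.ite_le_one _
    have htmp := execOps_cons_fwd hR; clear hR; obtain ⟨v2, hv2, hR⟩ := htmp
    simp -failIfUnchanged (disch := omega) only [Operand.write, Operand.read, merge_apply_of_lt,
      merge_apply_of_le, Function.update_self, Function.update_of_ne, update_merge_of_lt,
      update_merge_of_le, Nat.add_zero, Nat.zero_add, BinOp.eval_mod, BinOp.eval_eq, BinOp.eval_band,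
      BinOp.eval_shr, BinOp.eval_div, BinOp.eval_lt, BinOp.eval_add_of_lt, BinOp.eval_sub_of_le,
      BinOp.eval_mul_of_lt, h19₂, h22₂, h24₂, h27₂, h38₂, h51₂, h52₂, h55₂, h56₂] at hv2 hR
    have hv2' : v2 ≤ 1 := hv2 ▸ NegTriToAPSP.ite_le_one _
    have h3 : sv * v2 ≤ sv := by simpa using Nat.mul_le_mul_left sv hv2'
    have htmp := execOps_cons_fwd hR; clear hR; obtain ⟨v3, hv3, hR⟩ := htmp
    simp -failIfUnchanged (disch := omega) only [Operand.write, Operand.read, merge_apply_of_lt,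
      merge_apply_of_le, Function.update_self, Function.update_of_ne, update_merge_of_lt,
      update_merge_of_le, Nat.add_zero, Nat.zero_add, BinOp.eval_mod, BinOp.eval_eq, BinOp.eval_band,
      BinOp.eval_shr, BinOp.eval_div, BinOp.eval_lt, BinOp.eval_add_of_lt, BinOp.eval_sub_of_le,
      BinOp.eval_mul_of_lt, h19₂, h22₂, h24₂, h27₂, h38₂, h51₂, h52₂, h55₂, h56₂] at hv3 hR
    have h4 : v3 ≤ M2 := by
      rw [← hv3, ← hv2]; split_ifs
      · simp; omega
      · simp
    have htmp := execOps_cons_fwd hR; clear hR; obtain ⟨v4, hv4, hR⟩ := htmp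
    simp -failIfUnchanged (disch := omega) only [Operand.write, Operand.read, merge_apply_of_lt,
      merge_apply_of_le, Function.update_self, Function.update_of_ne, update_merge_of_lt,
      update_merge_of_le, Nat.add_zero, Nat.zero_add, BinOp.eval_mod, BinOp.eval_eq, BinOp.eval_band,
      BinOp.eval_shr, BinOp.eval_div, BinOp.eval_lt, BinOp.eval_add_of_lt, BinOp.eval_sub_of_le,
      BinOp.eval_mul_of_lt, h19₂, h22₂, h24₂, h27₂, h38₂, h51₂, h52₂, h55₂, h56₂] at hv4 hR
    have h5 : v4 * v2 ≤ v4 := by simpa using Nat.mul_le_mul_left v4 hv2'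
    have htmp := execOps_cons_fwd hR; clear hR; obtain ⟨v5, hv5, hR⟩ := htmp
    simp -failIfUnchanged (disch := omega) only [Operand.write, Operand.read, merge_apply_of_lt,
      merge_apply_of_le, Function.update_self, Function.update_of_ne, update_merge_of_lt,
      update_merge_of_le, Nat.add_zero, Nat.zero_add, BinOp.eval_mod, BinOp.eval_eq, BinOp.eval_band,
      BinOp.eval_shr, BinOp.eval_div, BinOp.eval_lt, BinOp.eval_add_of_lt, BinOp.eval_sub_of_le,
      BinOp.eval_mul_of_lt, h19₂, h22₂, h24₂, h27₂, h38₂, h51₂, h52₂, h55₂, h56₂] at hv5 hR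
    have h6 : M2 * v1 ≤ M2 := by simpa using Nat.mul_le_mul_left M2 hv1'
    have htmp := execOps_cons_fwd hR; clear hR; obtain ⟨v6, hv6, hR⟩ := htmp
    simp -failIfUnchanged (disch := omega) only [Operand.write, Operand.read, merge_apply_of_lt,
      merge_apply_of_le, Function.update_self, Function.update_of_ne, update_merge_of_lt,
      update_merge_of_le, Nat.add_zero, Nat.zero_add, BinOp.eval_mod, BinOp.eval_eq, BinOp.eval_band,
      BinOp.eval_shr, BinOp.eval_div, BinOp.eval_lt, BinOp.eval_add_of_lt, BinOp.eval_sub_of_le,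
      BinOp.eval_mul_of_lt, h19₂, h22₂, h24₂, h27₂, h38₂, h51₂, h52₂, h55₂, h56₂] at hv6 hR
    have h7 : v6 ≤ sv := by rw [← hv6, ← hv1]; split_ifs <;> simp; omega
    have htmp := execOps_cons_fwd hR; clear hR; obtain ⟨v7, hv7, hR⟩ := htmp
    simp -failIfUnchanged (disch := omega) only [Operand.write, Operand.read, merge_apply_of_lt,
      merge_apply_of_le, Function.update_self, Function.update_of_ne, update_merge_of_lt,
      update_merge_of_le, Nat.add_zero, Nat.zero_add, BinOp.eval_mod, BinOp.eval_eq, BinOp.eval_band,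
      BinOp.eval_shr, BinOp.eval_div, BinOp.eval_lt, BinOp.eval_add_of_lt, BinOp.eval_sub_of_le,
      BinOp.eval_mul_of_lt, h19₂, h22₂, h24₂, h27₂, h38₂, h51₂, h52₂, h55₂, h56₂] at hv7 hR
    have h8 : v7 * v1 ≤ v7 := by simpa using Nat.mul_le_mul_left v7 hv1'
    have htmp := execOps_cons_fwd hR; clear hR; obtain ⟨v8, hv8, hR⟩ := htmp
    simp -failIfUnchanged (disch := omega) only [Operand.write, Operand.read, merge_apply_of_lt,
      merge_apply_of_le, Function.update_self, Function.update_of_ne, update_merge_of_lt,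
      update_merge_of_le, Nat.add_zero, Nat.zero_add, BinOp.eval_mod, BinOp.eval_eq, BinOp.eval_band,
      BinOp.eval_shr, BinOp.eval_div, BinOp.eval_lt, BinOp.eval_add_of_lt, BinOp.eval_sub_of_le,
      BinOp.eval_mul_of_lt, h19₂, h22₂, h24₂, h27₂, h38₂, h51₂, h52₂, h55₂, h56₂] at hv8 hR
    have htmp := execOps_cons_fwd hR; clear hR; obtain ⟨v9, hv9, hR⟩ := htmp
    simp -failIfUnchanged (disch := omega) only [Operand.write, Operand.read, merge_apply_of_lt,
      merge_apply_of_le, Function.update_self, Function.update_of_ne, update_merge_of_lt,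
      update_merge_of_le, Nat.add_zero, Nat.zero_add, BinOp.eval_mod, BinOp.eval_eq, BinOp.eval_band,
      BinOp.eval_shr, BinOp.eval_div, BinOp.eval_lt, BinOp.eval_add_of_lt, BinOp.eval_sub_of_le,
      BinOp.eval_mul_of_lt, h19₂, h22₂, h24₂, h27₂, h38₂, h51₂, h52₂, h55₂, h56₂] at hv9 hR
    have htmp := execOps_cons_fwd hR; clear hR; obtain ⟨v10, hv10, hR⟩ := htmp
    simp -failIfUnchanged (disch := omega) only [Operand.write, Operand.read, merge_apply_of_lt,
      merge_apply_of_le, Function.update_self, Function.update_of_ne, update_merge_of_lt,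
      update_merge_of_le, Nat.add_zero, Nat.zero_add, BinOp.eval_mod, BinOp.eval_eq, BinOp.eval_band,
      BinOp.eval_shr, BinOp.eval_div, BinOp.eval_lt, BinOp.eval_add_of_lt, BinOp.eval_sub_of_le,
      BinOp.eval_mul_of_lt, h19₂, h22₂, h24₂, h27₂, h38₂, h51₂, h52₂, h55₂, h56₂] at hv10 hR
    have htmp := execOps_cons_fwd hR; clear hR; obtain ⟨v11, hv11, hR⟩ := htmp
    simp -failIfUnchanged (disch := omega) only [Operand.write, Operand.read, merge_apply_of_lt,
      merge_apply_of_le, Function.update_self, Function.update_of_ne, update_merge_of_lt,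
      update_merge_of_le, Nat.add_zero, Nat.zero_add, BinOp.eval_mod, BinOp.eval_eq, BinOp.eval_band,
      BinOp.eval_shr, BinOp.eval_div, BinOp.eval_lt, BinOp.eval_add_of_lt, BinOp.eval_sub_of_le,
      BinOp.eval_mul_of_lt, h19₂, h22₂, h24₂, h27₂, h38₂, h51₂, h52₂, h55₂, h56₂] at hv11 hR
    have h12 : v11 * f ≤ v11 := by simpa using Nat.mul_le_mul_left v11 hf1
    have htmp := execOps_cons_fwd hR; clear hR; obtain ⟨v12, hv12, hR⟩ := htmp
    simp -failIfUnchanged (disch := omega) only [Operand.write, Operand.read, merge_apply_of_lt,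
      merge_apply_of_le, Function.update_self, Function.update_of_ne, update_merge_of_lt,
      update_merge_of_le, Nat.add_zero, Nat.zero_add, BinOp.eval_mod, BinOp.eval_eq, BinOp.eval_band,
      BinOp.eval_shr, BinOp.eval_div, BinOp.eval_lt, BinOp.eval_add_of_lt, BinOp.eval_sub_of_le,
      BinOp.eval_mul_of_lt, h19₂, h22₂, h24₂, h27₂, h38₂, h51₂, h52₂, h55₂, h56₂] at hv12 hR
    have h13 : f * BIGC ≤ BIGC := by simpa using Nat.mul_le_mul_right BIGC hf1
    have htmp := execOps_cons_fwd hR; clear hR; obtain ⟨v13, hv13, hR⟩ := htmp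
    simp -failIfUnchanged (disch := omega) only [Operand.write, Operand.read, merge_apply_of_lt,
      merge_apply_of_le, Function.update_self, Function.update_of_ne, update_merge_of_lt,
      update_merge_of_le, Nat.add_zero, Nat.zero_add, BinOp.eval_mod, BinOp.eval_eq, BinOp.eval_band,
      BinOp.eval_shr, BinOp.eval_div, BinOp.eval_lt, BinOp.eval_add_of_lt, BinOp.eval_sub_of_le,
      BinOp.eval_mul_of_lt, h19₂, h22₂, h24₂, h27₂, h38₂, h51₂, h52₂, h55₂, h56₂] at hv13 hR
    have htmp := execOps_cons_fwd hR; clear hR; obtain ⟨v14, hv14, hR⟩ := htmp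
    simp -failIfUnchanged (disch := omega) only [Operand.write, Operand.read, merge_apply_of_lt,
      merge_apply_of_le, Function.update_self, Function.update_of_ne, update_merge_of_lt,
      update_merge_of_le, Nat.add_zero, Nat.zero_add, BinOp.eval_mod, BinOp.eval_eq, BinOp.eval_band,
      BinOp.eval_shr, BinOp.eval_div, BinOp.eval_lt, BinOp.eval_add_of_lt, BinOp.eval_sub_of_le,
      BinOp.eval_mul_of_lt, h19₂, h22₂, h24₂, h27₂, h38₂, h51₂, h52₂, h55₂, h56₂] at hv14 hR
    have htmp := execOps_cons_fwd hR; clear hR; obtain ⟨v15, hv15, hR⟩ := htmp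
    simp -failIfUnchanged (disch := omega) only [Operand.write, Operand.read, merge_apply_of_lt,
      merge_apply_of_le, Function.update_self, Function.update_of_ne, update_merge_of_lt,
      update_merge_of_le, Nat.add_zero, Nat.zero_add, BinOp.eval_mod, BinOp.eval_eq, BinOp.eval_band,
      BinOp.eval_shr, BinOp.eval_div, BinOp.eval_lt, BinOp.eval_add_of_lt, BinOp.eval_sub_of_le,
      BinOp.eval_mul_of_lt, h19₂, h22₂, h24₂, h27₂, h38₂, h51₂, h52₂, h55₂, h56₂] at hv15 hR
    have h16 : iu * L3 ≤ iu * L3 + iv := Nat.le_add_right _ _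
    have htmp := execOps_cons_fwd hR; clear hR; obtain ⟨v16, hv16, hR⟩ := htmp
    simp -failIfUnchanged (disch := omega) only [Operand.write, Operand.read, merge_apply_of_lt,
      merge_apply_of_le, Function.update_self, Function.update_of_ne, update_merge_of_lt,
      update_merge_of_le, Nat.add_zero, Nat.zero_add, BinOp.eval_mod, BinOp.eval_eq, BinOp.eval_band,
      BinOp.eval_shr, BinOp.eval_div, BinOp.eval_lt, BinOp.eval_add_of_lt, BinOp.eval_sub_of_le,
      BinOp.eval_mul_of_lt, h19₂, h22₂, h24₂, h27₂, h38₂, h51₂, h52₂, h55₂, h56₂] at hv16 hR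
    have htmp := execOps_cons_fwd hR; clear hR; obtain ⟨v17, hv17, hR⟩ := htmp
    simp -failIfUnchanged (disch := omega) only [Operand.write, Operand.read, merge_apply_of_lt,
      merge_apply_of_le, Function.update_self, Function.update_of_ne, update_merge_of_lt,
      update_merge_of_le, Nat.add_zero, Nat.zero_add, BinOp.eval_mod, BinOp.eval_eq, BinOp.eval_band,
      BinOp.eval_shr, BinOp.eval_div, BinOp.eval_lt, BinOp.eval_add_of_lt, BinOp.eval_sub_of_le,
      BinOp.eval_mul_of_lt, h19₂, h22₂, h24₂, h27₂, h38₂, h51₂, h52₂, h55₂, h56₂] at hv17 hR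
    have htmp := execOps_cons_fwd hR; clear hR; obtain ⟨v18, hv18, hR⟩ := htmp
    simp -failIfUnchanged (disch := omega) only [Operand.write, Operand.read, merge_apply_of_lt,
      merge_apply_of_le, Function.update_self, Function.update_of_ne, update_merge_of_lt,
      update_merge_of_le, Nat.add_zero, Nat.zero_add, BinOp.eval_mod, BinOp.eval_eq, BinOp.eval_band,
      BinOp.eval_shr, BinOp.eval_div, BinOp.eval_lt, BinOp.eval_add_of_lt, BinOp.eval_sub_of_le,
      BinOp.eval_mul_of_lt, h19₂, h22₂, h24₂, h27₂, h38₂, h51₂, h52₂, h55₂, h56₂] at hv18 hR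
    have htmp := execOps_cons_fwd hR; clear hR; obtain ⟨v19, hv19, hR⟩ := htmp
    simp -failIfUnchanged (disch := omega) only [Operand.write, Operand.read, merge_apply_of_lt,
      merge_apply_of_le, Function.update_self, Function.update_of_ne, update_merge_of_lt,
      update_merge_of_le, Nat.add_zero, Nat.zero_add, BinOp.eval_mod, BinOp.eval_eq, BinOp.eval_band,
      BinOp.eval_shr, BinOp.eval_div, BinOp.eval_lt, BinOp.eval_add_of_lt, BinOp.eval_sub_of_le,
      BinOp.eval_mul_of_lt, h19₂, h22₂, h24₂, h27₂, h38₂, h51₂, h52₂, h55₂, h56₂] at hv19 hR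
    simp only [execOps_nil] at hR; subst hR
    subst hv19 hv18 hv17 hv16 hv15 hv14 hv13 hv12 hv11 hv10 hv9 hv8 hv7 hv6 hv5 hv4 hv3
    refine ⟨_, _, rfl, fun i h53 h54 h57 h58 h59 => ?_, ?_⟩
    · simp only [Function.update_of_ne, ne_eq, not_false_eq_true, h53, h54, h57, h58, h59]
    · congr 1
      · omega
      have hE : (M2 - sv * v2) * v2 + (sv - M2 * v1) * v1 = (M2 - sv) + (sv - M2) := by
        rw [← hv1, ← hv2]
        by_cases hb : M2 < sv
        · rw [if_pos hb, if_neg (by omega)]; simp; omega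
        · rw [if_neg hb, if_pos (by omega)]; simp; omega
      have hz : ((M2 - sv * v2) * v2 + (sv - M2 * v1) * v1 + ((M2 - sv * v2) * v2 + (sv - M2 * v1) * v1) + v2)
          = zzCode M2 sv := by
        rw [hE, zzCode, ← hv2]
        by_cases hb : sv < M2 + 1
        · rw [if_pos hb, if_pos (by omega)]; ring
        · rw [if_neg hb, if_neg (by omega)]; ring
      rw [hz, Nat.mul_comm]
  -- assemble
  refine ⟨S₃, H₃, hex₁.seqs_cons (hex₂.seqs_cons (Exec.seqs_one hex₃)), fun i hi => ?_, ?_, ?_⟩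
  · rw [hS₃ i (by omega) (by omega) (by omega) (by omega) (by omega),
      hS₂ i (by omega) (by omega) (by omega) (by omega), hS₁ i hi]
  · rw [hS₃ 50 (by omega) (by omega) (by omega) (by omega) (by omega),
      hS₂ 50 (by omega) (by omega) (by omega) (by omega), h50₁]
  · rw [hH₃]
    congr 1
    rw [tbVal, hf, hsv, hf₁]
    by_cases hc : bi * L + iv < n ∧ bj * L + iu < n ∧ iv * nfr = rsel ∧ iu * nfc = csel
    · simp only [hc, and_self, if_true, true_and, Nat.one_mul]
      by_cases he : H (FDB + idx) = pw
      · rw [if_neg (by simpa using he), if_neg (by simpa using he)]; simp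
      · rw [if_pos he, if_pos he]; simp [hidx]
    · rw [if_neg hc, if_neg (fun h => hc h.1), if_neg (fun h => hc ⟨h.1, h.2.1, h.2.2.1, h.2.2.2.1⟩)]
      simp

/-- **Semantics of `buildT`.** With count `L²` in `r50`, the loop writes, within `46 L² + 1` steps,
the code `tbVal` of every back arc `(iu, iv)` at `TB + iu L3 + iv`, leaves every other data cell
and the registers outside `50–59` intact, and makes no query. [folklore] -/
theorem buildT_spec {w : ℕ} {O : List ℕ → List ℕ}
    {n F FDB M2 BIGC pw L L3 TB bi bj nfr rsel nfc csel : ℕ} {S H : ℕ → ℕ} {qs : List (List ℕ)}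
    (h2 : S 2 = n) (h9 : S 9 = F) (h19 : S 19 = M2 + 1) (h22 : S 22 = M2) (h24 : S 24 = BIGC)
    (h25 : S 25 = L) (h27 : S 27 = L3) (h30 : S 30 = FDB) (h38 : S 38 = TB) (h40 : S 40 = pw)
    (h42 : S 42 = bi) (h43 : S 43 = bj) (h46 : S 46 = nfr) (h47 : S 47 = rsel) (h48 : S 48 = nfc)
    (h49 : S 49 = csel) (h50 : S 50 = L * L)
    (hn : 1 ≤ n) (hL : 1 ≤ L) (hL3 : L3 = 3 * L) (hbi : bi * L < n) (hbj : bj * L < n)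
    (hnfr : nfr ≤ 1) (hnfc : nfc ≤ 1) (hF : 100 ≤ F) (hFDB : FDB = F + n * n) (hTB : FDB + n * n ≤ TB)
    (hBIG : BIGC = 16 * M2 + 9) (hpw : 1 ≤ pw)
    (hlo : ∀ t, t < n * n → H (F + t) + pw ≤ 4 * M2 + 2) (hfd : ∀ t, t < n * n → H (FDB + t) < 2 ^ w)
    (hcapB : 2 * BIGC < 2 ^ w) (hcapN : (n + L) * n + (n + L) < 2 ^ w) (hcapT : TB + L * L3 < 2 ^ w) :
    ∃ S' H', ExecLE w O buildT ⟨merge S H, qs⟩ ⟨merge S' H', qs⟩ (L * L * 46 + 1) ∧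
      (∀ i, i < 50 ∨ 59 < i → S' i = S i) ∧
      (∀ r, r < L * L → H' (TB + r / L * L3 + r % L) =
        tbVal H n F FDB M2 BIGC pw L bi bj nfr rsel nfc csel (r / L) (r % L)) ∧
      (∀ a, (∀ r, r < L * L → a ≠ TB + r / L * L3 + r % L) → H' a = H a) := by
  -- `tbVal` only reads `lo` and `fd`, which the loop does not touch
  have hval : ∀ H' : ℕ → ℕ, (∀ a, a < TB → H' a = H a) → ∀ iu iv,
      tbVal H' n F FDB M2 BIGC pw L bi bj nfr rsel nfc csel iu iv =
        tbVal H n F FDB M2 BIGC pw L bi bj nfr rsel nfc csel iu iv := by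
    intro H' hH' iu iv
    unfold tbVal
    by_cases hc : bi * L + iv < n ∧ bj * L + iu < n
    · have hi : (bi * L + iv) * n + (bj * L + iu) < n * n := NegTriToAPSP.mul_add_lt_mul hc.1 hc.2
      rw [hH' _ (by omega), hH' _ (by omega)]
    · rw [if_neg (fun h => hc ⟨h.1, h.2.1⟩), if_neg (fun h => hc ⟨h.1, h.2.1⟩)]
  obtain ⟨st', hex, S', H', rfl, hS', -, hw, hnw⟩ := ExecLE.whilenz_invariant (w := w) (O := O)
    (x := .dir 50) (s := seqs [block buildTOps1, block buildTOps2, block buildTOps3]) (L * L) 44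
    (fun i st => ∃ S' H', st = ⟨merge S' H', qs⟩ ∧ (∀ j, j < 50 ∨ 59 < j → S' j = S j) ∧
      S' 50 = L * L - i ∧
      (∀ r, L * L - i ≤ r → r < L * L → H' (TB + r / L * L3 + r % L) =
        tbVal H n F FDB M2 BIGC pw L bi bj nfr rsel nfc csel (r / L) (r % L)) ∧
      (∀ a, (∀ r, L * L - i ≤ r → r < L * L → a ≠ TB + r / L * L3 + r % L) → H' a = H a))
    (fun i hi st ⟨S', H', hst, hS', h50', hw, hnw⟩ => by
      subst hst
      refine ⟨by rw [Operand.read_dir_merge (by norm_num), h50']; omega, ?_⟩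
      have hlow : ∀ a, a < TB → H' a = H a := fun a ha => hnw a fun r _ _ => by omega
      obtain ⟨S'', H'', hex, hS'', h50'', hH''⟩ := buildT_iter (O := O) (qs := qs) (r := L * L - i - 1)
        ((hS' 2 (by omega)).trans h2) ((hS' 9 (by omega)).trans h9) ((hS' 19 (by omega)).trans h19)
        ((hS' 22 (by omega)).trans h22) ((hS' 24 (by omega)).trans h24) ((hS' 25 (by omega)).trans h25)
        ((hS' 27 (by omega)).trans h27) ((hS' 30 (by omega)).trans h30) ((hS' 38 (by omega)).trans h38)
        ((hS' 40 (by omega)).trans h40) ((hS' 42 (by omega)).trans h42) ((hS' 43 (by omega)).trans h43)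
        ((hS' 46 (by omega)).trans h46) ((hS' 47 (by omega)).trans h47) ((hS' 48 (by omega)).trans h48)
        ((hS' 49 (by omega)).trans h49) (by rw [h50']; omega)
        hn hL hL3 (by omega) hbi hbj hnfr hnfc hF hFDB hTB hBIG hpw
        (H := H') (fun t ht => by rw [hlow _ (by omega)]; exact hlo t ht)
        (fun t ht => by rw [hlow _ (by omega)]; exact hfd t ht) hcapB hcapN hcapT
      refine ⟨_, hex.execLE, S'', H'', rfl, fun j hj => ?_, by rw [h50'']; omega, ?_, ?_⟩
      · rw [hS'' j hj, hS' j hj]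
      · intro r hr1 hr2
        rw [hH'']
        rcases Nat.lt_or_ge r (L * L - i) with hlt | hge
        · have hr : r = L * L - i - 1 := by omega
          subst hr
          rw [Function.update_self]
          exact hval H' hlow _ _
        · rw [Function.update_of_ne, hw r hge hr2]
          intro heq
          have := strided_inj (r := r) (r' := L * L - i - 1) hL (show L ≤ L3 by omega) (by omega)
          omega
      · intro a ha
        rw [hH'', Function.update_of_ne (ha _ (by omega) (by omega)), hnw a fun r hr1 hr2 => ha r (by omega) hr2])
    (fun st ⟨S', H', hst, _, h50', _⟩ => by
      subst hst; rw [Operand.read_dir_merge (by norm_num), h50']; omega)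
    ⟨S, H, rfl, fun j _ => rfl, by rw [h50]; rfl, fun r h1 h2 => by omega, fun a _ => rfl⟩
  refine ⟨S', H', ?_, hS', fun r hr => hw r (by omega) hr, fun a ha => hnw a fun r _ hr => ha r hr⟩
  unfold buildT
  convert hex using 1

end Literature.Computability.FineGrained.NegTriSweep
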